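import Literature.NumberTheory.EllipticCurves.ZpExtensionEisensteinPiTorsionCutInputsProofs
import Literature.NumberTheory.EllipticCurves.GaloisCohomologyTwoAnnihilationOfCardProofs
import Literature.NumberTheory.EllipticCurves.ZpExtensionEisensteinPiLevelH2BoundProofs
import HarnessLib

/-!
# The `H²`-annihilation inputs (hH2Fil), (hH2) of the torsion-cut readout at `w ∣ p`, from the `H²`-counts
# (theorems only — no definition, no named fact, no instance, no `sorry`)

Topic `NumberTheory/EllipticCurves` (cell `pub/bsd-print-x9`, shared μ-crux, registered stub `stub_h5bAtS`; brick (v) of the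
uniform-`ι` road for Howard's H.5(b) at `v ∣ p`, instance layer).  Companion of `ZpExtensionEisensteinPiTorsionCutInputsProofs`
((hTor-inst)/(hF2-inst)/(hLift-inst) for the curve's `π`-adic Eisenstein tower `D := E.eisensteinPiRefinementDatum κ hm` at a place
`w`, which keep the `H²`-annihilations `hH2Fil` / `hH2` as hypotheses) and of `GaloisCohomologyTwoAnnihilationOfCardProofs`
(COUNT ⇒ ANNIHILATION).  Here the `H²`-count of `ZpExtensionEisensteinPiLevelH2BoundProofs`
(`WeierstrassCurve.natCard_two_piFil_le`: `#H²(K_w, Fil_w(T/π^iT)) ≤ p^{p^s}`) is converted into the annihilation letter: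

* **`WeierstrassCurve.piTorsionCut_hH2Fil`** — for every endomorphism `t` of the plus-part subrepresentation `piFil i` acting as
  `π^{p^s}`, `H²(t) = 0` on `H²(K_w, piFil i)` (binders: the cyclic-generator / scalar data `P₀, hgen, λ, c` of the count, `κ(g₀) = p^s`,
  `p^s < m`, `i ≥ 1`) — with `T n := π^n •|_{piFil}`, `A := (−π^{m−1}) •|_{piFil}` (`GaloisCohomologyTwoAnnihilationOfCardProofs` §4,
  `smul_mem_piFil`), `p • x = T 1 (A x)` from `π^m + p = 0` (`pi_pow_smul_add_natCast_zsmul_eq_zero`), `T i = 0`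
  (`PiRefinementDatum.pow_smul_level_eq_zero`).

The level twin (hH2) is the one-line application of `galoisCohomology_scalarMap_two_pow_eq_zero_of_natCard_le_pow` to the
level count `#H²(K_w, T/π^iT) ≤ p^{2p^s}` (brick (F4c-3)(iv)); recorded here as `WeierstrassCurve.piTorsionCut_hH2_of_natCard_le`
with the count as a hypothesis.

References: B. Howard, Compositio Math. 140 (2004), Lemma 3.2.7 (arXiv:1202.6340 p. 16 L150–156), §3.1, §2.2 and proof of Thm. 2.2.10;
Milne, *ADT* (2006), I Cor. 2.3; Greenberg, LNM 1716 (1999), §2.  No summit statement is proved; BSD is not proved by any of this.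
-/

set_option autoImplicit false

noncomputable section

open Function NumberField IsDedekindDomain Field
open scoped NumberField ContRepresentation

namespace WeierstrassCurve

open Literature.NumberTheory.EllipticCurves Literature.NumberTheory.GaloisRepresentations
open Literature.NumberTheory.GaloisRepresentations.DiscreteGaloisModule
open Literature.NumberTheory.EllipticCurves.ZpExtension (EisensteinLevel OrdinaryFiltration)
open Literature.NumberTheory.GaloisCohomology.Howard2004

variable {K : Type} [Field K] [NumberField K] (E : WeierstrassCurve K) [E.IsElliptic] {p : ℕ} [hp : Fact p.Prime]
  (κ : Literature.NumberTheory.EllipticCurves.ZpExtension K p) {m : ℕ} (hm : 1 ≤ m) (w : HeightOneSpectrum (𝓞 K))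
  (Φ : OrdinaryFiltration (fun j ↦ E.torsionGaloisModule ((p : ℤ) ^ j)) (fun j ↦ E.torsionGaloisModuleReduce p j) w)

set_option maxHeartbeats 800000 in
-- the statement re-elaborates the binders of `natCard_two_piFil_le` (same budget as there)
/-- **(hH2Fil) at `w`**: `H²(t) = 0` on `H²(K_w, Fil_w(T/π^iT))` for every endomorphism `t` of the plus-part subrepresentation
acting as `π^{p^s}` — the annihilation letter consumed by `piTorsionCut_hF2`, from the count `natCard_two_piFil_le`
(`#H² ≤ p^{p^s}`) by the finite-`p`-group argument (`p = π · (−π^{m−1})`, `π` nilpotent on the level).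
[cite: Howard2004HeegnerKolyvagin, Lemma 3.2.7 (arXiv:1202.6340 p. 16 L150–156), §2.2 and proof of Thm. 2.2.10]
[cite: MilneADT2006, Ch. I Cor. 2.3] [cite: GreenbergLNM1716, §2 and proof of Prop. 4.15] -/
theorem piTorsionCut_hH2Fil {i : ℕ} (hi : 1 ≤ i)
    (P₀ : E.geomTorsion ((p : ℤ) ^ (E.eisensteinPiRefinementDatum κ hm).host i))
    (hP₀ : P₀ ∈ Φ.fil ((E.eisensteinPiRefinementDatum κ hm).host i))
    (hgen : ∀ a ∈ Φ.fil ((E.eisensteinPiRefinementDatum κ hm).host i), ∃ n : ℤ, n • P₀ = a)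
    {g₀ : absoluteGaloisGroup (w.adicCompletion K)} {s : ℕ}
    (hg₀ : (κ (absGaloisRestrict K (w.adicCompletion K) g₀)).toAdd = ((p ^ s : ℕ) : ℤ_[p])) (hms : p ^ s < m)
    (lam : ℤ) (hlam : E.torsionGaloisModule ((p : ℤ) ^ (E.eisensteinPiRefinementDatum κ hm).host i)
      (absGaloisRestrict K (w.adicCompletion K) g₀) P₀ = lam • P₀)
    (c : ℤ) (hc : ∀ ζ : MuCarrier (w.adicCompletion K) (p ^ (E.eisensteinPiRefinementDatum κ hm).host i),
      mu (w.adicCompletion K) (p ^ (E.eisensteinPiRefinementDatum κ hm).host i) g₀ ζ = c • ζ)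
    (hcp : ¬ (p : ℤ) ∣ c)
    (t : ((GaloisRep.toLocal w ((E.eisensteinPiRefinementDatum κ hm).levelRep i)).subrepresentation
        (E.piFil κ hm Φ i) (E.piFil_le_comap κ hm Φ i)).toContRepresentation →ⁱL
      ((GaloisRep.toLocal w ((E.eisensteinPiRefinementDatum κ hm).levelRep i)).subrepresentation
        (E.piFil κ hm Φ i) (E.piFil_le_comap κ hm Φ i)).toContRepresentation)
    (ht : ∀ x : E.piFil κ hm Φ i, ((t x : E.piFil κ hm Φ i) : (E.eisensteinPiRefinementDatum κ hm).Level i) =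
      (E.eisensteinPiRefinementDatum κ hm).π ^ (p ^ s) • (x : (E.eisensteinPiRefinementDatum κ hm).Level i))
    (z : galoisCohomology ((GaloisRep.toLocal w ((E.eisensteinPiRefinementDatum κ hm).levelRep i)).subrepresentation
        (E.piFil κ hm Φ i) (E.piFil_le_comap κ hm Φ i)) 2) :
    galoisCohomology.map t 2 z = 0 := by
  obtain ⟨hfin, hcard⟩ := E.natCard_two_piFil_le κ hm Φ hi P₀ hP₀ hgen hg₀ hms lam hlam c hc hcp
  haveI : Finite (galoisCohomology ((GaloisRep.toLocal w ((E.eisensteinPiRefinementDatum κ hm).levelRep i)).subrepresentation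
      (E.piFil κ hm Φ i) (E.piFil_le_comap κ hm Φ i)) 2) := hfin
  -- the scalar endomorphisms `π^n •` and `(-π^(m-1)) •` of the plus part
  obtain ⟨T, hT⟩ := exists_subScalarPowFamily_apply
    (ρ := GaloisRep.toLocal w ((E.eisensteinPiRefinementDatum κ hm).levelRep i))
    (((E.eisensteinPiRefinementDatum κ hm).isScalarLinear_levelRep i).restrictField _) (E.piFil κ hm Φ i)
    (E.piFil_le_comap κ hm Φ i) (fun r x hx ↦ E.smul_mem_piFil κ hm w Φ i r x hx) (E.eisensteinPiRefinementDatum κ hm).π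
  obtain ⟨A, hA⟩ := exists_subScalarEndo_apply
    (ρ := GaloisRep.toLocal w ((E.eisensteinPiRefinementDatum κ hm).levelRep i))
    (((E.eisensteinPiRefinementDatum κ hm).isScalarLinear_levelRep i).restrictField _) (E.piFil κ hm Φ i)
    (E.piFil_le_comap κ hm Φ i) (fun r x hx ↦ E.smul_mem_piFil κ hm w Φ i r x hx)
    (-(E.eisensteinPiRefinementDatum κ hm).π ^ (m - 1))
  refine galoisCohomology_map_two_eq_zero_of_natCard_le_pow_of_forall_apply_eq hp.out T
    (fun x ↦ Subtype.ext (by rw [hT, pow_zero, one_smul]))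
    (fun n x ↦ Subtype.ext (by rw [hT, hT, hT, pow_one, smul_smul, ← pow_succ']))
    A (fun x ↦ Subtype.ext (by rw [hT, hA, hA, hT, smul_smul, smul_smul, pow_one, mul_comm]))
    (fun x ↦ Subtype.ext ?_) ⟨i, fun x ↦ Subtype.ext ?_⟩ hcard t (fun x ↦ Subtype.ext (by rw [ht, hT])) z
  · -- `p • x = π • ((-π^(m-1)) • x)` from `π^m • x + p • x = 0`
    have h := E.pi_pow_smul_add_natCast_zsmul_eq_zero κ hm i (x : (E.eisensteinPiRefinementDatum κ hm).Level i)
    rw [natCast_zsmul, add_eq_zero_iff_neg_eq'] at h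
    have key : (E.eisensteinPiRefinementDatum κ hm).π * -(E.eisensteinPiRefinementDatum κ hm).π ^ (m - 1) =
        -((E.eisensteinPiRefinementDatum κ hm).π ^ m) := by
      have e : (E.eisensteinPiRefinementDatum κ hm).π * -(E.eisensteinPiRefinementDatum κ hm).π ^ (m - 1) =
          -((E.eisensteinPiRefinementDatum κ hm).π ^ (m - 1 + 1)) := by ring
      rwa [Nat.sub_add_cancel hm] at e
    rw [AddSubmonoidClass.coe_nsmul, hT, hA, pow_one, smul_smul, key, neg_smul, ← h, neg_neg]
  · -- `π^i` kills the level, hence the plus part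
    rw [hT, ZeroMemClass.coe_zero]
    exact (E.eisensteinPiRefinementDatum κ hm).pow_smul_level_eq_zero i _

/-- **(hH2) at `w` from a level count**: if `H²(K_w, T/π^jT)` is finite of order `≤ p^{c'}` for every level `j`, then
`H²(π^{c'} •) = 0` on every `H²(K_w, Level j)` — the `hH2` letter of `piTorsionCut_hLift`
(`galoisCohomology_scalarMap_two_pow_eq_zero_of_natCard_le_pow` with `p = π · (−π^{m−1})`, `π^j · Level j = 0`).
[cite: Howard2004HeegnerKolyvagin, Lemma 3.2.7 (arXiv:1202.6340 p. 16 L150–156), §2.2 and proof of Thm. 2.2.10] [cite: MilneADT2006, Ch. I Cor. 2.3] -/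
theorem piTorsionCut_hH2_of_natCard_le {c' : ℕ}
    (hfin : ∀ j, Finite (galoisCohomology (GaloisRep.toLocal w ((E.eisensteinPiRefinementDatum κ hm).levelRep j)) 2))
    (hcard : ∀ j, Nat.card (galoisCohomology (GaloisRep.toLocal w ((E.eisensteinPiRefinementDatum κ hm).levelRep j)) 2) ≤ p ^ c')
    (j : ℕ) (z : galoisCohomology (GaloisRep.toLocal w ((E.eisensteinPiRefinementDatum κ hm).levelRep j)) 2) :
    galoisCohomology.scalarMap (GaloisRep.toLocal w ((E.eisensteinPiRefinementDatum κ hm).levelRep j))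
      (((E.eisensteinPiRefinementDatum κ hm).isScalarLinear_levelRep j).restrictField _) 2
      ((E.eisensteinPiRefinementDatum κ hm).π ^ c') z = 0 := by
  haveI : Finite (galoisCohomology (GaloisRep.restrictField (w.adicCompletion K)
      ((E.eisensteinPiRefinementDatum κ hm).levelRep j)) 2) := hfin j
  refine galoisCohomology_scalarMap_two_pow_eq_zero_of_natCard_le_pow
    (((E.eisensteinPiRefinementDatum κ hm).isScalarLinear_levelRep j).restrictField _) hp.out
    (E.eisensteinPiRefinementDatum κ hm).π (-(E.eisensteinPiRefinementDatum κ hm).π ^ (m - 1)) ?_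
    ⟨j, fun x ↦ (E.eisensteinPiRefinementDatum κ hm).pow_smul_level_eq_zero j x⟩ (hcard j) z
  -- `(p : S_𝔮) = π · (−π^(m−1))`
  have key : (E.eisensteinPiRefinementDatum κ hm).π * -(E.eisensteinPiRefinementDatum κ hm).π ^ (m - 1) =
      -((E.eisensteinPiRefinementDatum κ hm).π ^ m) := by
    have e : (E.eisensteinPiRefinementDatum κ hm).π * -(E.eisensteinPiRefinementDatum κ hm).π ^ (m - 1) =
        -((E.eisensteinPiRefinementDatum κ hm).π ^ (m - 1 + 1)) := by ring
    rwa [Nat.sub_add_cancel hm] at e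
  rw [key, E.eisensteinPiRefinementDatum_π κ hm, IwasawaAlgebra.natCast_eq_neg_mk_X_pow_quotient_X_pow_add_C p m]

end WeierstrassCurve

end
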